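import Summits.QuantumFields.QCD.Theorems.QuarksAsStableActionCriticalLineDiamagnetismCellSecondOrderAux6

/-!
# B6 cell sub-stub `cellSecondOrder` of the line `Sketch`: the bubble bound, assembled for torus sizes `2n ≥ 24`
(crux `stmt-QuantumFields-9734`, decl `Summit.QuantumFields.QCD.Theses.QuarksAsStableAction.CriticalLineDiamagnetism`,
Route B step B6; sub-problem context `Summits/QuantumFields/QCD/Statement.lean`)

`|Re Tr X²| ≤ 8 n² def(P) (bubbleAbs M_ω (sin ω₀) (sin ω₁) 14 7 + 10⁻⁴)` for the checkerboard perturbation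
`X = D_1⁻¹(D_P − D_1)` of the free 2D frequency operator on `(ℤ/2n)²`, on the heavy box `|m| ≤ 1/10`,
`cos ω_i ≤ −199/200` (so `M_ω ∈ [5.89, 6.1]`), for `n ≥ 12` (registered: `cellSecondOrderOfTwelve`).

Proof (files `…CellSecondOrderAux1–6`): `|Tr X²| ≤ 2 def Σ_{x,x′ odd} pairAbs x′ x` (colour triviality of the free
propagator, link support of `Δ`, `|tr₃((U−1)(U′−1))| ≤ 2 def`); each odd-row row sum is `≤ 2 bubbleAbs + tails` (near
partners: planar identification of the torus walk sums of length `≤ 14` between points at `ℓ¹`-distance `≤ 8`, which needs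
`8 + 14 < 2n`; far partners: Neumann decay `(2/M)^{tdist}`); there are `2n · n` odd-row cell links; and the tails
`57 · 16τ(2γ+τ) + 640 γ² q¹⁴/(1 − q²)²` are `≤ 2 · 10⁻⁴` for `M ≥ 5.89` (`tails_le`).
The threshold `n ≥ 12` (rather than the `n ≥ 9` of the originally registered `cellSecondOrder`) is exactly the no-wrapping
condition `22 < 2n` of the planar identification at walk length `14`.
-/

noncomputable section

open scoped BigOperators Matrix Kronecker ComplexConjugate Matrix.Norms.L2Operator
open Matrix Literature.MathematicalPhysics.QuantumLattice
open Summit.QuantumFields.QCD.Cruxes.CriticalLineDiamagnetism.ChessboardCellGain.CellKappa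
open Summit.QuantumFields.QCD.Cruxes.CriticalLineDiamagnetism.ChessboardCellGain.FrequencyDiamagnetism
open Summit.QuantumFields.QCD.Cruxes.CriticalLineDiamagnetism.ChessboardCellGain.Cell

namespace Summit.QuantumFields.QCD.Cruxes.CriticalLineDiamagnetism.ChessboardCellGain

namespace CellWalk

variable {L : ℕ} [NeZero L]

omit [NeZero L] in
/-- The number of odd-row sites of `(ℤ/2n)²` is `2n · n`. -/
theorem sum_odd_indicator (n : ℕ) [NeZero n] :
    ∑ x : ZMod (2 * n) × ZMod (2 * n), (if x.2.val % 2 = 1 then (1 : ℝ) else 0) = 2 * n * n := by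
  have aux : ∀ m : ℕ, ∑ i ∈ Finset.range (2 * m), (if i % 2 = 1 then (1 : ℝ) else 0) = m := by
    intro m
    induction m with
    | zero => simp
    | succ m ih =>
      rw [show 2 * (m + 1) = 2 * m + 1 + 1 by ring, Finset.sum_range_succ, Finset.sum_range_succ, ih,
        if_neg (by omega), if_pos (by omega)]
      push_cast; ring
  have h1 : ∑ b : ZMod (2 * n), (if b.val % 2 = 1 then (1 : ℝ) else 0) = n := by
    rw [← aux n]
    refine Finset.sum_bij (fun b _ => b.val) (fun b _ => Finset.mem_range.2 (ZMod.val_lt b))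
      (fun b₁ _ b₂ _ h => ZMod.val_injective _ h) (fun i hi => ⟨(i : ZMod (2 * n)), Finset.mem_univ _,
        ZMod.val_cast_of_lt (Finset.mem_range.1 hi)⟩) (fun b _ => rfl)
  rw [Fintype.sum_prod_type]
  simp only [Finset.sum_const, Finset.card_univ, ZMod.card, nsmul_eq_mul, h1]
  push_cast; ring


/-- The far tail in closed form: `Σ_{tdist v ≥ 8} 16 γ² q^{2(tdist v − 1)} ≤ 640 γ² x⁷/(1 − x)²`, `x = q²`. -/
theorem farSum_le (M : ℝ) (hM : 2 < M) :
    ∑ v : ZMod L × ZMod L, (if 8 ≤ tdist v then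
        16 * ((1 - 2 / M)⁻¹ * (1 / M)) ^ 2 * ((2 / M) ^ (tdist v - 1)) ^ 2 else 0) ≤
      640 * ((1 - 2 / M)⁻¹ * (1 / M)) ^ 2 * ((2 / M) ^ 2) ^ 7 / (1 - (2 / M) ^ 2) ^ 2 := by
  set q := 2 / M with hq
  set γ := (1 - 2 / M)⁻¹ * (1 / M) with hγ
  set x := q ^ 2 with hx
  have hM0 : 0 < M := by linarith
  have hq1 : q < 1 := (div_lt_one hM0).2 hM
  have hq0 : 0 < q := by positivity
  have hx0 : 0 < x := by positivity
  have hx1 : x < 1 := by rw [hx]; nlinarith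
  have hpt : ∀ v : ZMod L × ZMod L, (if 8 ≤ tdist v then 16 * γ ^ 2 * (q ^ (tdist v - 1)) ^ 2 else 0) =
      16 * γ ^ 2 * x⁻¹ * (if 8 ≤ tdist v then x ^ tdist v else 0) := by
    intro v
    split_ifs with h
    · have e1 : (q ^ (tdist v - 1)) ^ 2 = x ^ (tdist v - 1) := by rw [hx, ← pow_mul, mul_comm, pow_mul]
      have e2 : x ^ (tdist v - 1) = x ^ tdist v * x⁻¹ := by
        rw [eq_mul_inv_iff_mul_eq₀ hx0.ne', pow_sub_one_mul (by omega)]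
      rw [e1, e2]; ring
    · simp
  rw [Finset.sum_congr rfl (fun v _ => hpt v), ← Finset.mul_sum]
  calc 16 * γ ^ 2 * x⁻¹ * ∑ v : ZMod L × ZMod L, (if 8 ≤ tdist v then x ^ tdist v else 0)
      ≤ 16 * γ ^ 2 * x⁻¹ * (4 * (8 + 2) * x ^ 8 / (1 - x) ^ 2) :=
        mul_le_mul_of_nonneg_left (by exact_mod_cast sum_torus_far_le (L := L) x hx0.le hx1 8 (by norm_num))
          (by positivity)
    _ = 640 * γ ^ 2 * x ^ 7 / (1 - x) ^ 2 := by
        field_simp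
        ring

omit [NeZero L] in
/-- The tails are below `10⁻⁴` on the heavy box (`M ≥ 5.89`). -/
theorem tails_le (M : ℝ) (hM : 589 / 100 ≤ M) :
    (57 * (4 * (4 * ((2 / M) ^ (14 + 1) * (1 - 2 / M)⁻¹ * (1 / M)) *
        (2 * ((1 - 2 / M)⁻¹ * (1 / M)) + (2 / M) ^ (14 + 1) * (1 - 2 / M)⁻¹ * (1 / M)))) +
      640 * ((1 - 2 / M)⁻¹ * (1 / M)) ^ 2 * ((2 / M) ^ 2) ^ 7 / (1 - (2 / M) ^ 2) ^ 2) / 2 ≤ 1 / 10 ^ 4 := by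
  set A := (2 / M) ^ (14 + 1) * (1 - 2 / M)⁻¹ * (1 / M) with hA
  set B := (1 - 2 / M)⁻¹ * (1 / M) with hB
  set C := (2 / M) ^ 2 with hC
  have hM0 : 0 < M := by linarith
  have hq0 : 0 ≤ 2 / M := by positivity
  have hqb : 2 / M ≤ 200 / 589 := by
    rw [div_le_div_iff₀ hM0 (by norm_num)]; linarith
  have hinv : (1 - 2 / M)⁻¹ ≤ 589 / 389 := by
    have := inv_anti₀ (by norm_num : (0 : ℝ) < 389 / 589) (by linarith : 389 / 589 ≤ 1 - 2 / M)
    linarith [show ((389 : ℝ) / 589)⁻¹ = 589 / 389 by norm_num]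
  have hinv0 : 0 ≤ (1 - 2 / M)⁻¹ := inv_nonneg.2 (by linarith)
  have hM1 : 1 / M ≤ 100 / 589 := by rw [div_le_div_iff₀ hM0 (by norm_num)]; linarith
  have hM10 : 0 ≤ 1 / M := by positivity
  have hA0 : 0 ≤ A := by positivity
  have hB0 : 0 ≤ B := by positivity
  have hC0 : 0 ≤ C := by positivity
  have hAb : A ≤ (200 / 589 : ℝ) ^ (14 + 1) * (589 / 389) * (100 / 589) := by
    rw [hA]
    exact mul_le_mul (mul_le_mul (pow_le_pow_left₀ hq0 hqb _) hinv hinv0 (by positivity)) hM1 hM10 (by positivity)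
  have hBb : B ≤ (589 / 389 : ℝ) * (100 / 589) := by
    rw [hB]; exact mul_le_mul hinv hM1 hM10 (by positivity)
  have hCb : C ≤ (200 / 589 : ℝ) ^ 2 := by rw [hC]; exact pow_le_pow_left₀ hq0 hqb 2
  have hC1 : (200 / 589 : ℝ) ^ 2 < 1 := by norm_num
  calc (57 * (4 * (4 * A * (2 * B + A))) + 640 * B ^ 2 * C ^ 7 / (1 - C) ^ 2) / 2
      ≤ (57 * (4 * (4 * ((200 / 589 : ℝ) ^ (14 + 1) * (589 / 389) * (100 / 589)) *
            (2 * ((589 / 389 : ℝ) * (100 / 589)) + (200 / 589 : ℝ) ^ (14 + 1) * (589 / 389) * (100 / 589)))) +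
          640 * ((589 / 389 : ℝ) * (100 / 589)) ^ 2 * ((200 / 589 : ℝ) ^ 2) ^ 7 / (1 - (200 / 589 : ℝ) ^ 2) ^ 2) / 2 := by
        gcongr
    _ ≤ 1 / 10 ^ 4 := by norm_num

omit [NeZero L] in
/-- **Main assembly (general torus size `2n ≥ 24`)**: `|Re Tr X²| ≤ 8 n² def(P) (bubbleAbs 14 7 + 10⁻⁴)` on the heavy
box. -/
theorem cellSecondOrder_of_le : ∀ (n : ℕ) [NeZero n], 12 ≤ n → ∀ (m : ℝ), |m| ≤ 1 / 10 → ∀ ω₀ ω₁ : ℝ,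
    Real.cos ω₀ ≤ -(199 / 200) → Real.cos ω₁ ≤ -(199 / 200) → ∀ (P : Matrix.unitaryGroup (Fin 3) ℂ),
    |((X n P m ω₀ ω₁ ^ 2).trace).re| ≤
      8 * (n : ℝ) ^ 2 * defi P * (bubbleAbs (bigM m ω₀ ω₁) (Real.sin ω₀) (Real.sin ω₁) 14 7 + 1 / 10 ^ 4) := by
  intro n _ hn m hm ω₀ ω₁ h0 h1 P
  set M := bigM m ω₀ ω₁ with hMdef
  have hmb := abs_le.1 hm
  have hM : 589 / 100 ≤ M := by rw [hMdef, bigM]; linarith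
  have hM2 : 2 < M := by linarith
  have hL : (23 : ℤ) ≤ (2 * n : ℕ) := by push_cast; omega
  have hL2 : 2 ∣ 2 * n := dvd_mul_right 2 n
  set s₀ := Real.sin ω₀
  set s₁ := Real.sin ω₁
  set ε := 57 * (4 * (4 * ((2 / M) ^ (14 + 1) * (1 - 2 / M)⁻¹ * (1 / M)) *
        (2 * ((1 - 2 / M)⁻¹ * (1 / M)) + (2 / M) ^ (14 + 1) * (1 - 2 / M)⁻¹ * (1 / M)))) +
      640 * ((1 - 2 / M)⁻¹ * (1 / M)) ^ 2 * ((2 / M) ^ 2) ^ 7 / (1 - (2 / M) ^ 2) ^ 2 with hε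
  have hεb : ε / 2 ≤ 1 / 10 ^ 4 := tails_le M hM
  have hd := defi_nonneg P
  set ind : ZMod (2 * n) × ZMod (2 * n) → ℝ := fun x => if x.2.val % 2 = 1 then 1 else 0 with hind
  have hind0 : ∀ x, 0 ≤ ind x := fun x => by simp only [hind]; split_ifs <;> norm_num
  -- row sums
  have hRS : ∀ xc : ZMod (2 * n) × ZMod (2 * n),
      ind xc * ∑ xp, ind xp * pairAbs (2 * n) M s₀ s₁ xc xp ≤ ind xc * (2 * bubbleAbs M s₀ s₁ 14 7 + ε) := by
    intro xc
    by_cases hxc : xc.2.val % 2 = 1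
    · refine mul_le_mul_of_nonneg_left ?_ (hind0 xc)
      refine (rowSum_le M s₀ s₁ hM2 hL hL2 xc hxc).trans ?_
      have := farSum_le (L := 2 * n) M hM2
      rw [hε]; linarith
    · simp only [hind, if_neg hxc, zero_mul, le_refl]
  have htr := norm_trace_X_sq_le (n := n) P m ω₀ ω₁
  have hcount := sum_odd_indicator n
  calc |((X n P m ω₀ ω₁ ^ 2).trace).re| ≤ ‖(X n P m ω₀ ω₁ ^ 2).trace‖ := Complex.abs_re_le_norm _
    _ ≤ 2 * defi P * ∑ x : ZMod (2 * n) × ZMod (2 * n), ∑ x' : ZMod (2 * n) × ZMod (2 * n),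
          ind x * ind x' * pairAbs (2 * n) M s₀ s₁ x' x := htr
    _ = 2 * defi P * ∑ x' : ZMod (2 * n) × ZMod (2 * n),
          ind x' * ∑ x : ZMod (2 * n) × ZMod (2 * n), ind x * pairAbs (2 * n) M s₀ s₁ x' x := by
        congr 1
        rw [Finset.sum_comm]
        refine Finset.sum_congr rfl fun x' _ => ?_
        rw [Finset.mul_sum]
        refine Finset.sum_congr rfl fun x _ => ?_
        ring
    _ ≤ 2 * defi P * ∑ x' : ZMod (2 * n) × ZMod (2 * n), ind x' * (2 * bubbleAbs M s₀ s₁ 14 7 + ε) :=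
        mul_le_mul_of_nonneg_left (Finset.sum_le_sum fun x' _ => hRS x') (mul_nonneg (by norm_num) hd)
    _ = 2 * defi P * ((2 * bubbleAbs M s₀ s₁ 14 7 + ε) * (2 * n * n)) := by
        rw [← Finset.sum_mul, hcount]; ring
    _ = 8 * (n : ℝ) ^ 2 * defi P * (bubbleAbs M s₀ s₁ 14 7 + ε / 2) := by ring
    _ ≤ 8 * (n : ℝ) ^ 2 * defi P * (bubbleAbs M s₀ s₁ 14 7 + 1 / 10 ^ 4) :=
        mul_le_mul_of_nonneg_left (by linarith) (mul_nonneg (by positivity) hd)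

end CellWalk

open Cell CellKappa CellWalk

/-- **Registered theorem `cellSecondOrderOfTwelve`** — the B6 cell sub-stub `cellSecondOrder` of the line `Sketch` with
the torus-size threshold `12 ≤ n` (the planar identification at walk length `14` between points at `ℓ¹`-distance `≤ 8`
needs `22 < 2n`): `|Re Tr X²| ≤ 8 n² def(P) · (bubbleAbs M_ω (sin ω₀) (sin ω₁) 14 7 + 10⁻⁴)`. -/
theorem cellSecondOrderOfTwelve : ∀ (n : ℕ) [NeZero n], 12 ≤ n → ∀ (m : ℝ), |m| ≤ 1 / 10 → ∀ ω₀ ω₁ : ℝ, Real.cos ω₀ ≤ -(199 / 200) → Real.cos ω₁ ≤ -(199 / 200) → ∀ (P : Matrix.unitaryGroup (Fin 3) ℂ), |((X n P m ω₀ ω₁ ^ 2).trace).re| ≤ 8 * (n : ℝ) ^ 2 * defi P * (bubbleAbs (bigM m ω₀ ω₁) (Real.sin ω₀) (Real.sin ω₁) 14 7 + 1 / 10 ^ 4) :=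
  fun n _ hn m hm ω₀ ω₁ h0 h1 P => CellWalk.cellSecondOrder_of_le n hn m hm ω₀ ω₁ h0 h1 P

end Summit.QuantumFields.QCD.Cruxes.CriticalLineDiamagnetism.ChessboardCellGain

end
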